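import Mathlib
import Summits.CriticalPhenomena.SAWScalingLimit.Theorems.SAWDevelopingMapNoFoldBoundWalledWalks

/-!
# Port decomposition of the SAW parafermionic observable at a walled vertex

Helper file for the crux `NoFoldBound` (stmt-CriticalPhenomena-8296) of the route
`SAWDevelopingMap` (sub-problem `SAWScalingLimit` of `CriticalPhenomena`), line `Ideator3Sketch`:
it proves the stub `stub_walledPorts` of that line.

Setting (Duminil-Copin–Smirnov 2012, §2): a finite vertex set `Λ` of the hexagonal lattice `ℍ`,
a source mid-edge `a`, a vertex `v ∈ Λ` off `a` with a neighbour `u ∉ Λ` (the port `{v, u}` is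
*walled*) and the two other neighbours `w₁, w₂` of `v`.  A *first arrival* at `v` through `w_j`
is a self-avoiding walk from `a` to the mid-edge `{v, w_j}` not visiting `v`; write
`P_j = Σ_{first arrivals through w_j} e^{-iσ W} x^ℓ` and `F(z) = F_Λ(a, z, x, σ)`.

* **`portOut`** — `F({v,u}) = x e^{-iσ W(w₁→v→u)} P₁ + x e^{-iσ W(w₂→v→u)} P₂`: a walk to the
  walled port ends at `v` (`u ∉ Λ`) and is a first arrival through `w₁` or `w₂` followed by `v`
  (`WalledPorts.exists_eq_concat_out`, `exists_init`, `snoc_*`, `weight_mk_concat` of the walks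
  file `SAWDevelopingMapNoFoldBoundWalledWalks.lean`).
* **`portIn`** — `F({v,w₁}) = P₁ + x e^{-iσ W(w₂→v→w₁)} P₂`: a walk to the live port `{v, w₁}`
  either avoids `v`, or ends at `v` entered from `w₂` (`WalledPorts.exists_eq_concat_in`: no
  returning loops through `v`, the third port being walled, and no U-turn).
* **`stub_walledPorts`** — the registered conjunction of the two, for all real `x, σ` and without
  any simple-connectivity assumption.

Here `W(w→v→t)` is the winding of the three-point polyline `mid{w,v}, c(v), mid{v,t}` (`±π/3`).
-/

noncomputable section

open scoped BigOperators
open Literature.Probability.LatticeModels Literature.Probability.RandomPlanarGeometry.SAW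

namespace Summit.CriticalPhenomena.SAWScalingLimit.Theorems.SAWDevelopingMapNoFoldBound

namespace WalledPorts

variable {Λ : Finset HexVertex} {a : Sym2 HexVertex} {u v w₁ w₂ : HexVertex}
  (hu : u ∉ Λ) (hv : v ∈ Λ) (hva : v ∉ a) (huv : hexGraph.Adj v u)
  (h₁ : hexGraph.Adj v w₁) (h₂ : hexGraph.Adj v w₂) (hu₁ : u ≠ w₁) (hu₂ : u ≠ w₂) (h₁₂ : w₁ ≠ w₂)

include hu hv hva huv h₁ h₂ hu₁ hu₂ h₁₂ in
/-- **The walled port.** `F(a; {v,u}) = Σ_{j=1,2} x e^{-iσ W(mid{w_j,v} → c(v) → mid{v,u})} ·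
Σ_{first arrivals at v through w_j} weight`: prolongation through `v` is a bijection from the
first arrivals through `w₁` or `w₂` onto the walks to `{v, u}`, multiplying the weights by
`x e^{-iσ W(w_j→v→u)}`. -/
theorem portOut (x σ : ℝ) :
    hexParafermionicObservable Λ a x σ s(v, u) =
      (x : ℂ) * Complex.exp (-Complex.I * σ *
          (winding [hexMidpoint s(w₁, v), hexCenter v, hexMidpoint s(v, u)] : ℝ)) *
        (∑ γ : HexMidEdgeSAW Λ a s(v, w₁), if v ∉ γ.verts then γ.weight x σ else 0) +
      (x : ℂ) * Complex.exp (-Complex.I * σ *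
          (winding [hexMidpoint s(w₂, v), hexCenter v, hexMidpoint s(v, u)] : ℝ)) *
        (∑ γ : HexMidEdgeSAW Λ a s(v, w₂), if v ∉ γ.verts then γ.weight x σ else 0) := by
  -- the prolongation through `v` of the first arrivals, a bijection onto the walks to `{v, u}`
  set Φ : {δ : HexMidEdgeSAW Λ a s(v, w₁) // v ∉ δ.verts} ⊕
      {δ : HexMidEdgeSAW Λ a s(v, w₂) // v ∉ δ.verts} → HexMidEdgeSAW Λ a s(v, u) :=
    Sum.elim
      (fun δ => ⟨δ.1.verts ++ [v], snoc_subset δ.1 hv, snoc_nodup δ.1 δ.2,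
        snoc_isChain δ.1 hva h₁ δ.2, snoc_head_mem δ.1 hva, snoc_getLast_mem δ.1,
        snoc_eq_of_nil δ.1, fun _ => snoc_edges_nodup δ.1 hva hu₁ δ.2, δ.1.fst_mem⟩)
      (fun δ => ⟨δ.1.verts ++ [v], snoc_subset δ.1 hv, snoc_nodup δ.1 δ.2,
        snoc_isChain δ.1 hva h₂ δ.2, snoc_head_mem δ.1 hva, snoc_getLast_mem δ.1,
        snoc_eq_of_nil δ.1, fun _ => snoc_edges_nodup δ.1 hva hu₂ δ.2, δ.1.fst_mem⟩)
    with hΦ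
  have hbij : Function.Bijective Φ := by
    constructor
    · rintro (δ | δ) (δ' | δ') h <;> have h' := congrArg HexMidEdgeSAW.verts h <;>
        simp only [hΦ, Sum.elim_inl, Sum.elim_inr] at h' <;>
        have h'' := List.append_cancel_right h'
      · exact congrArg Sum.inl (Subtype.ext (HexMidEdgeSAW.ext h''))
      · have e₁ := getLast?_eq δ.1 hva δ.2
        rw [h'', getLast?_eq δ'.1 hva δ'.2, Option.some_inj] at e₁
        exact absurd e₁.symm h₁₂
      · have e₁ := getLast?_eq δ.1 hva δ.2
        rw [h'', getLast?_eq δ'.1 hva δ'.2, Option.some_inj] at e₁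
        exact absurd e₁ h₁₂
      · exact congrArg Sum.inr (Subtype.ext (HexMidEdgeSAW.ext h''))
    · intro γ
      obtain ⟨L, hL⟩ := exists_eq_concat_out hu hva γ
      obtain ⟨y, hy, hyΛ, hyu, δ, hvδ, hγδ⟩ := exists_init γ hva hL
      rcases SourceLoopBound.eq_or_eq_or_eq_of_adj huv h₁ h₂ hu₁ hu₂ h₁₂ hy with h | h | h
      · exact absurd h hyu
      · subst h
        exact ⟨Sum.inl ⟨δ, hvδ⟩, HexMidEdgeSAW.ext hγδ.symm⟩
      · subst h
        exact ⟨Sum.inr ⟨δ, hvδ⟩, HexMidEdgeSAW.ext hγδ.symm⟩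
  rw [hexParafermionicObservable_def,
    ← Fintype.sum_bijective Φ hbij (fun p => (Φ p).weight x σ) _ fun _ => rfl,
    Fintype.sum_sum_type]
  simp only [hΦ, Sum.elim_inl, Sum.elim_inr, weight_mk_concat _ hva]
  rw [← sum_subtype_eq_sum_ite (fun δ : HexMidEdgeSAW Λ a s(v, w₁) => v ∉ δ.verts),
    ← sum_subtype_eq_sum_ite (fun δ : HexMidEdgeSAW Λ a s(v, w₂) => v ∉ δ.verts),
    Finset.mul_sum, Finset.mul_sum]

include hu hv hva huv h₁ h₂ hu₁ hu₂ h₁₂ in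
/-- **The live port.** `F(a; {v,w₁}) = Σ_{first arrivals through w₁} weight +
x e^{-iσ W(mid{w₂,v} → c(v) → mid{v,w₁})} · Σ_{first arrivals through w₂} weight`: a walk to
`{v, w₁}` either avoids `v`, or is a first arrival through `w₂` prolonged through `v`. -/
theorem portIn (x σ : ℝ) :
    hexParafermionicObservable Λ a x σ s(v, w₁) =
      (∑ γ : HexMidEdgeSAW Λ a s(v, w₁), if v ∉ γ.verts then γ.weight x σ else 0) +
      (x : ℂ) * Complex.exp (-Complex.I * σ *
          (winding [hexMidpoint s(w₂, v), hexCenter v, hexMidpoint s(v, w₁)] : ℝ)) *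
        (∑ γ : HexMidEdgeSAW Λ a s(v, w₂), if v ∉ γ.verts then γ.weight x σ else 0) := by
  set Φ : {γ : HexMidEdgeSAW Λ a s(v, w₁) // v ∉ γ.verts} ⊕
      {δ : HexMidEdgeSAW Λ a s(v, w₂) // v ∉ δ.verts} → HexMidEdgeSAW Λ a s(v, w₁) :=
    Sum.elim (fun γ => γ.1)
      (fun δ => ⟨δ.1.verts ++ [v], snoc_subset δ.1 hv, snoc_nodup δ.1 δ.2,
        snoc_isChain δ.1 hva h₂ δ.2, snoc_head_mem δ.1 hva, snoc_getLast_mem δ.1,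
        snoc_eq_of_nil δ.1, fun _ => snoc_edges_nodup δ.1 hva h₁₂ δ.2, δ.1.fst_mem⟩)
    with hΦ
  have hbij : Function.Bijective Φ := by
    constructor
    · rintro (δ | δ) (δ' | δ') h <;>
        simp only [hΦ, Sum.elim_inl, Sum.elim_inr] at h
      · exact congrArg Sum.inl (Subtype.ext h)
      · exact absurd (h ▸ δ.2) (by simp)
      · exact absurd (h ▸ δ'.2) (by simp)
      · have h' := congrArg HexMidEdgeSAW.verts h
        exact congrArg Sum.inr (Subtype.ext (HexMidEdgeSAW.ext (List.append_cancel_right h')))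
    · intro γ
      by_cases hvγ : v ∈ γ.verts
      · obtain ⟨L, hL⟩ := exists_eq_concat_in hu hva huv h₁ h₂ hu₁ hu₂ h₁₂ γ hvγ
        obtain ⟨y, hy, hyΛ, hy₁, δ, hvδ, hγδ⟩ := exists_init γ hva hL
        rcases SourceLoopBound.eq_or_eq_or_eq_of_adj huv h₁ h₂ hu₁ hu₂ h₁₂ hy with h | h | h
        · exact absurd (h ▸ hyΛ) hu
        · exact absurd h hy₁
        · subst h
          exact ⟨Sum.inr ⟨δ, hvδ⟩, HexMidEdgeSAW.ext hγδ.symm⟩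
      · exact ⟨Sum.inl ⟨γ, hvγ⟩, rfl⟩
  rw [hexParafermionicObservable_def,
    ← Fintype.sum_bijective Φ hbij (fun p => (Φ p).weight x σ) _ fun _ => rfl,
    Fintype.sum_sum_type]
  simp only [hΦ, Sum.elim_inl, Sum.elim_inr, weight_mk_concat _ hva]
  rw [← sum_subtype_eq_sum_ite (fun δ : HexMidEdgeSAW Λ a s(v, w₁) => v ∉ δ.verts),
    ← sum_subtype_eq_sum_ite (fun δ : HexMidEdgeSAW Λ a s(v, w₂) => v ∉ δ.verts),
    Finset.mul_sum]

end WalledPorts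

/-- **Stub W3 (port decomposition at a walled vertex).** For `v ∈ Λ` off the source mid-edge `a`,
with a neighbour `u ∉ Λ` and other neighbours `w₁, w₂`: a walk from `a` to `{v, u}` is a first
arrival at `v` through `w₁` or `w₂` (a walk to `{v, w_j}` avoiding `v`) followed by the vertex `v`;
a walk from `a` to `{v, w₁}` either avoids `v` (a first arrival through `w₁`) or is a first arrival
through `w₂` followed by `v` (no returning loops: the third port is walled). Weights multiply by
`x e^{-iσ·turn}`. Valid for every fugacity `x` and spin `σ`, without simple connectivity. -/
theorem stub_walledPorts :
    ∀ (Λ : Finset HexVertex) (a : Sym2 HexVertex) (u v w₁ w₂ : HexVertex), u ∉ Λ → v ∈ Λ → v ∉ a →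
      hexGraph.Adj v u → hexGraph.Adj v w₁ → hexGraph.Adj v w₂ → u ≠ w₁ → u ≠ w₂ → w₁ ≠ w₂ →
      ∀ (x σ : ℝ),
        hexParafermionicObservable Λ a x σ s(v, u) =
            (x : ℂ) * Complex.exp (-Complex.I * σ *
                (winding [hexMidpoint s(w₁, v), hexCenter v, hexMidpoint s(v, u)] : ℝ)) *
              (∑ γ : HexMidEdgeSAW Λ a s(v, w₁), if v ∉ γ.verts then γ.weight x σ else 0) +
            (x : ℂ) * Complex.exp (-Complex.I * σ *
                (winding [hexMidpoint s(w₂, v), hexCenter v, hexMidpoint s(v, u)] : ℝ)) *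
              (∑ γ : HexMidEdgeSAW Λ a s(v, w₂), if v ∉ γ.verts then γ.weight x σ else 0) ∧
        hexParafermionicObservable Λ a x σ s(v, w₁) =
            (∑ γ : HexMidEdgeSAW Λ a s(v, w₁), if v ∉ γ.verts then γ.weight x σ else 0) +
            (x : ℂ) * Complex.exp (-Complex.I * σ *
                (winding [hexMidpoint s(w₂, v), hexCenter v, hexMidpoint s(v, w₁)] : ℝ)) *
              (∑ γ : HexMidEdgeSAW Λ a s(v, w₂), if v ∉ γ.verts then γ.weight x σ else 0) :=
  fun _Λ _a _u _v _w₁ _w₂ hu hv hva huv h₁ h₂ hu₁ hu₂ h₁₂ x σ =>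
    ⟨WalledPorts.portOut hu hv hva huv h₁ h₂ hu₁ hu₂ h₁₂ x σ,
      WalledPorts.portIn hu hv hva huv h₁ h₂ hu₁ hu₂ h₁₂ x σ⟩

end Summit.CriticalPhenomena.SAWScalingLimit.Theorems.SAWDevelopingMapNoFoldBound
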